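import Literature.NumberTheory.EllipticCurves.DeligneSerreProp27Proofs
import Literature.NumberTheory.EllipticCurves.DeligneSerreProp27WeightReductionProofs
import Literature.NumberTheory.EllipticCurves.EichlerShimuraPeriodsGamma1
import Literature.NumberTheory.EllipticCurves.NewformsCoeffFieldHolds
import HarnessLib

/-!
# Deligne–Serre 1974, Prop. 2.7 (2.7.3) on `S_k(Γ₁(N))`: unconditionally in weights `k ≥ 2`,
# and reduction of the named fact `prop27_eigenvalues` to (2.7.2) in weights `5` and `7`

D-0014 keeps `Literature/` sorry-free by stating cited results as named facts `def X : Prop`.  The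
named fact `DeligneSerre1974.prop27_eigenvalues` (`DeligneSerreRankinProofs`; Deligne–Serre, *Formes
modulaires de poids 1*, Prop. 2.7, p. 512: *"(2.7.3) Les valeurs propres des `T_p` dans `S_ℂ` sont
des entiers d'une extension finie de `ℚ`"*) says: for a non-zero cusp form `f` of type `(k, ε)` on
`Γ₀(N)` which is an eigenfunction of the `T_p`, `p ∤ N`, the eigenvalues `a_p` are algebraic
integers lying in one number field.  The tree derives it (all weights) from the spanning statement
(2.7.2), the named fact `DeligneSerre1974_span_integralLattice1 N k`
(`prop27_eigenvalues_of_span_integralLattice1`, `DeligneSerreProp27Proofs`).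

This file records what holds **without** (2.7.2):

* **Weights `k ≥ 2`, unconditionally** (`DeligneSerre1974.prop27_eigenvalues_of_two_le`): by the
  Eichler–Shimura period lattice `Λ = periodLatticeK1 n ⊆ S_{n+2}(Γ₁(N))^∧` of
  `EichlerShimuraPeriodsGamma1` — finitely generated, stable under all `T_p^∨` and `⟨d⟩^∨`,
  separating (`periodLatticeK1_fg_stable_separating`; Shimura 1971, (3.5.20) and §8.4) — the periods
  `{φ(f) : φ ∈ Λ} ⊆ ℂ` of `f ≠ 0` form a non-zero finitely generated group `M` with `a M ⊆ M` for
  every eigenvalue `a` of every `Λ^∨`-stable operator on `f`, so all such `a` lie in one subring of `ℂ`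
  finitely generated over `ℤ` (`SeparatingDualLattice.exists_fg_subalgebra_ev`, the stabiliser
  argument `exists_fg_subalgebra_of_mul_mem` of `NewformsCoeffFieldProofs`; Diamond–Shurman (6.12)).
  In operator form: `T_p` (every prime `p`, `U_p` included) and `⟨d⟩` are integral over `ℤ` on
  `S_k(Γ₁(N))`, `k ≥ 2` (`heckeT_gamma1_isIntegral_of_two_le`, `diamondOp_isIntegral_of_two_le`;
  Shimura 1971, Thm. 3.48 (3) for `Γ' = Γ₁(N)`, which is of type (3.3.2)); and, by the tree's
  dual-lattice fact `gamma0_exists_heckeStableDualLattice_holds`, `T_p` is integral on `S_k(Γ₀(N))`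
  in *every* weight (`heckeT_gamma0_isIntegral`, `isIntegral_of_heckeT_gamma0_apply_eq_smul`: the
  unconditional forms of `heckeT_isIntegral`, `isIntegral_of_heckeT_apply_eq_smul` of
  `HeckeIntegrality`, which assume the maximal-rank lattice (3.5.20)).
* **Reduction to weight one** (`DeligneSerre1974.prop27_eigenvalues_iff_weight_one`): the named fact
  is equivalent to its weight-one case (weights `≤ 0` are vacuous, `cuspForm_eq_zero_of_weight_nonpos`).
* **Weight one from (2.7.2) in weights `5` and `7`**
  (`DeligneSerre1974.prop27_eigenvalues_of_span_integralLattice1_five_seven`): by the tree's weight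
  reduction `DeligneSerre1974_span_integralLattice1.weight_one_of_five_seven` (division by `E₄`, `E₆`;
  Deligne–Serre Rem. 2.8) the whole fact follows from `DeligneSerre1974_span_integralLattice1 N 5` and
  `… N 7` for all `N` — sharpening `prop27_eigenvalues_of_span_integralLattice1`, which assumes (2.7.2)
  in every weight.

## What is not here, and why

Weight one is not discharged.  The period lattice exists only for `k ≥ 2`, and in weight one no
Hecke-stable integral structure on `S_1(Γ₁(N))` is available short of (2.7.2) itself: Deligne–Serre
obtain it from the modular stack and the Tate curve ((2.6.1), Rem. 2.8), or from Shimura's Thm. 3.52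
in weight `≥ 2` and multiplication by `Δ`.  Given the duality `a₁(T_n f) = a_n(f)`, (2.7.2) in a weight
`k ≥ 2` is equivalent to `dim_ℚ ℚ[T_n, ⟨d⟩] = dim_ℂ S_k(Γ₁(N))` (Shimura 1971, Thm. 3.51 (1)), whose
proof (Thm. 3.48 (2)) needs a lattice of *maximal rank* `2 dim S_k` — the real Eichler–Shimura
isomorphism, i.e. a dimension count for `H¹_P` — and the real structure `f ↦ f*`; the tree's period
lattice is only known to be finitely generated and separating.  So the remaining input of
`prop27_eigenvalues` is exactly the existing named fact `DeligneSerre1974_span_integralLattice1`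
(weights `5`, `7`).

## References

* P. Deligne, J.-P. Serre, *Formes modulaires de poids 1*, Ann. Sci. ÉNS (4) 7 (1974), 507–530,
  Prop. 2.7 and Rem. 2.8 (p. 512).
* G. Shimura, *Introduction to the arithmetic theory of automorphic functions*, Iwanami Shoten /
  Princeton UP, 1971: Thm. 3.48 (pp. 83–85), (3.5.20) (p. 84), Thm. 3.51, Thm. 3.52 (pp. 85–86),
  §8.4 (pp. 239–241).
* F. Diamond, J. Shurman, *A first course in modular forms*, GTM 228, Springer 2005, §6.5, (6.12).
-/

noncomputable section

open Module

namespace Literature.NumberTheory.EllipticCurves.ModularForms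

/-! ## 1. Separating, finitely generated lattices in the dual of a complex vector space -/

namespace SeparatingDualLattice

variable {V : Type*} [AddCommGroup V] [Module ℂ V]

variable {H : AddSubgroup (Module.Dual ℂ V)}

/-- **Operators whose transpose preserves a finitely generated separating subgroup `H` of the dual
are integral over `ℤ`.**  The operators `T` with `T^∨(H) ⊆ H` form a `ℤ`-subalgebra `S` of
`End_ℂ(V)` (the Hecke ring acting on an integral structure); `T ↦ T^∨|_H` is a `ℤ`-linear map
`S → End_ℤ(H)` — the target finitely generated, `H` being free of finite rank — which is injective
because `H` separates the points of `V`; so `S` is a finitely generated `ℤ`-module and its elements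
are integral (Shimura 1971, Thm. 3.48 (3) and its proof from (3.5.20), pp. 84–85; Diamond–Shurman
§6.5).  The dual form of `isIntegral_of_mapsTo_lattice` (`HeckeIntegrality`). [cite: Shimura1971, Thm. 3.48 (3), proof pp. 84–85] -/
theorem isIntegral_of_dualMap_mem (hH : H.FG) (hsep : ∀ v : V, (∀ φ ∈ H, φ v = 0) → v = 0)
    {T₀ : Module.End ℂ V} (hT₀ : ∀ φ ∈ H, T₀.dualMap φ ∈ H) : IsIntegral ℤ T₀ := by
  -- the stabiliser subalgebra
  let S : Subalgebra ℤ (Module.End ℂ V) :=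
    { carrier := {T | ∀ φ ∈ H, T.dualMap φ ∈ H}
      mul_mem' := by
        intro T T' hT hT' φ hφ
        have h : (T * T').dualMap φ = T'.dualMap (T.dualMap φ) := by
          ext v
          simp only [LinearMap.dualMap_apply, Module.End.mul_apply]
        rw [h]
        exact hT' _ (hT φ hφ)
      one_mem' := fun φ hφ ↦ by
        have h : (1 : Module.End ℂ V).dualMap φ = φ := by
          ext v
          simp only [LinearMap.dualMap_apply, Module.End.one_apply]
        rwa [h]
      add_mem' := by
        intro T T' hT hT' φ hφ
        have h : (T + T').dualMap φ = T.dualMap φ + T'.dualMap φ := by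
          ext v
          simp only [LinearMap.dualMap_apply, LinearMap.add_apply, map_add]
        rw [h]
        exact H.add_mem (hT φ hφ) (hT' φ hφ)
      zero_mem' := fun φ _ ↦ by
        have h : (0 : Module.End ℂ V).dualMap φ = 0 := by
          ext v
          simp only [LinearMap.dualMap_apply, LinearMap.zero_apply, map_zero]
        rw [h]
        exact H.zero_mem
      algebraMap_mem' := fun n φ hφ ↦ by
        have h : (algebraMap ℤ (Module.End ℂ V) n).dualMap φ = (n : ℂ) • φ := by
          ext v
          rw [LinearMap.dualMap_apply, eq_intCast, Module.End.intCast_apply, LinearMap.smul_apply,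
            ← Int.cast_smul_eq_zsmul ℂ n v, map_smul]
        rw [h, Int.cast_smul_eq_zsmul]
        exact H.zsmul_mem hφ n }
  -- `S` is a finitely generated `ℤ`-module: restriction to the lattice is injective
  set Λ : Submodule ℤ (Module.Dual ℂ V) := AddSubgroup.toIntSubmodule H with hΛ
  have hΛfg : Λ.FG := by
    rw [hΛ, Submodule.fg_iff_addSubgroup_fg, AddSubgroup.toIntSubmodule_toAddSubgroup]
    exact hH
  haveI : Module.Finite ℤ Λ := Module.Finite.iff_fg.mpr hΛfg
  haveI : IsAddTorsionFree (Module.Dual ℂ V) := IsAddTorsionFree.of_isTorsionFree ℂ _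
  let res : S →ₗ[ℤ] (Λ →ₗ[ℤ] Λ) :=
    { toFun := fun T ↦ (T.1.dualMap.restrictScalars ℤ).restrict fun φ hφ ↦ T.2 φ hφ
      map_add' := fun T T' ↦ by
        refine LinearMap.ext fun φ ↦ Subtype.ext <| LinearMap.ext fun v ↦ ?_
        simp [LinearMap.dualMap_apply]
      map_smul' := fun n T ↦ by
        refine LinearMap.ext fun φ ↦ Subtype.ext <| LinearMap.ext fun v ↦ ?_
        simp [LinearMap.dualMap_apply] }
  haveI : Module.Finite ℤ S := by
    refine Module.Finite.of_injective res fun T T' h ↦ ?_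
    apply Subtype.ext
    refine LinearMap.ext fun v ↦ ?_
    have key : ∀ φ ∈ H, φ (T.1 v - T'.1 v) = 0 := by
      intro φ hφ
      have h1 := congrArg (fun g : Λ →ₗ[ℤ] Λ ↦ ((g ⟨φ, hφ⟩ : Module.Dual ℂ V) v)) h
      simp only [res, LinearMap.coe_mk, AddHom.coe_mk, LinearMap.coe_restrict_apply,
        LinearMap.coe_restrictScalars, LinearMap.dualMap_apply] at h1
      rw [map_sub, h1, sub_self]
    exact sub_eq_zero.mp (hsep _ key)
  exact (IsIntegral.of_finite ℤ (⟨T₀, hT₀⟩ : S)).map S.val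

/-- **The eigenvalues of a common eigenvector of `H^∨`-stable operators lie in a subring of `ℂ`
finitely generated as a `ℤ`-module** (hence in an order of a number field), for `H ⊆ V^∧` finitely
generated and separating and `f ≠ 0`: the periods `M = {φ(f) : φ ∈ H}` form a non-zero finitely
generated subgroup of `ℂ` with `a M ⊆ M` whenever `T f = a f` and `T^∨ H ⊆ H`
(`φ(T f) = (T^∨ φ)(f)`), and the stabiliser of `M` in `ℂ` is finitely generated
(`exists_fg_subalgebra_of_mul_mem`).  This is the argument of Diamond–Shurman §6.5, (6.12), and
of Deligne–Serre 1974, (2.7.3). [folklore] -/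
theorem exists_fg_subalgebra_ev (hH : H.FG) (hsep : ∀ v : V, (∀ φ ∈ H, φ v = 0) → v = 0)
    {f : V} (hf : f ≠ 0) :
    ∃ K : Subalgebra ℤ ℂ, (Subalgebra.toSubmodule K).FG ∧
      ∀ (T : Module.End ℂ V) (c : ℂ), (∀ φ ∈ H, T.dualMap φ ∈ H) → T f = c • f → c ∈ K := by
  set Λ : Submodule ℤ (Module.Dual ℂ V) := AddSubgroup.toIntSubmodule H with hΛ
  have hΛfg : Λ.FG := by
    rw [hΛ, Submodule.fg_iff_addSubgroup_fg, AddSubgroup.toIntSubmodule_toAddSubgroup]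
    exact hH
  -- the group of periods of `f`
  set ev : Module.Dual ℂ V →ₗ[ℤ] ℂ := (Module.Dual.eval ℂ V f).restrictScalars ℤ with hev
  have hev_apply : ∀ φ : Module.Dual ℂ V, ev φ = φ f := fun φ ↦ rfl
  set M : Submodule ℤ ℂ := Λ.map ev with hM
  have hMfg : M.FG := hΛfg.map ev
  have hM0 : M ≠ ⊥ := by
    intro h0
    apply hf
    refine hsep f fun φ hφ ↦ ?_
    have hmem : φ f ∈ M := ⟨φ, hφ, hev_apply φ⟩
    rw [h0] at hmem
    exact (Submodule.mem_bot ℤ).mp hmem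
  set S : Set ℂ := {c | ∃ T : Module.End ℂ V, (∀ φ ∈ H, T.dualMap φ ∈ H) ∧ T f = c • f} with hS
  have hSM : ∀ s ∈ S, ∀ m ∈ M, s * m ∈ M := by
    rintro s ⟨T, hT, hTf⟩ _ ⟨φ, hφ, rfl⟩
    refine ⟨T.dualMap φ, hT φ hφ, ?_⟩
    rw [hev_apply, hev_apply, LinearMap.dualMap_apply, hTf, map_smul, smul_eq_mul]
  obtain ⟨K, hK, hSK⟩ := exists_fg_subalgebra_of_mul_mem M hMfg hM0 S hSM
  exact ⟨K, hK, fun T c hT hTf ↦ hSK ⟨T, hT, hTf⟩⟩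

end SeparatingDualLattice

/-! ## 2. Integrality of `T_p` on `S_k(Γ₁(N))`, `k ≥ 2`, and on `S_k(Γ₀(N))`, via the period lattices -/

section ModularForms

open scoped MatrixGroups
open CongruenceSubgroup

variable {N : ℕ} [NeZero N] {k : ℤ}

/-- **`T_p` is integral over `ℤ` on `S_k(Γ₁(N))` for `k ≥ 2`** — every prime `p`, `U_p` for `p ∣ N`
included, unconditionally: its transpose preserves the finitely generated separating period lattice
`periodLatticeK1` (`periodLatticeK1_fg_stable_separating`), so it lies in a `ℤ`-algebra finitely
generated as a module (`SeparatingDualLattice.isIntegral_of_dualMap_mem`).  Shimura 1971,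
Thm. 3.48 (3) for `Γ' = Γ₁(N)` (of type (3.3.2)): "the characteristic polynomial of `[X]_k` … has
rational integral coefficients". [cite: Shimura1971, Thm. 3.48 (3)] -/
theorem heckeT_gamma1_isIntegral_of_two_le (hk : 2 ≤ k) (p : ℕ) [NeZero p] (hp : p.Prime) :
    IsIntegral ℤ (heckeT (Gamma1 N) k p) := by
  obtain ⟨n, rfl⟩ : ∃ n : ℕ, k = (n : ℤ) + 2 := ⟨(k - 2).toNat, by omega⟩
  obtain ⟨hfg, hT, -, hsep⟩ := periodLatticeK1_fg_stable_separating N n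
  exact SeparatingDualLattice.isIntegral_of_dualMap_mem hfg hsep fun φ hφ ↦ hT p hp φ hφ

/-- The diamond operators `⟨d⟩` are integral over `ℤ` on `S_k(Γ₁(N))`, `k ≥ 2` (same argument with
`⟨d⟩^∨`-stability of the period lattice; of course also because `⟨d⟩` has finite order). [folklore] -/
theorem diamondOp_isIntegral_of_two_le (hk : 2 ≤ k) (d : ZMod N) :
    IsIntegral ℤ (diamondOp N k d) := by
  obtain ⟨n, rfl⟩ : ∃ n : ℕ, k = (n : ℤ) + 2 := ⟨(k - 2).toNat, by omega⟩
  obtain ⟨hfg, -, hd, hsep⟩ := periodLatticeK1_fg_stable_separating N n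
  exact SeparatingDualLattice.isIntegral_of_dualMap_mem hfg hsep fun φ hφ ↦ hd d φ hφ

/-- **Hecke eigenvalues on `S_k(Γ₁(N))`, `k ≥ 2`, are algebraic integers** (every prime `p`),
unconditionally: an eigenvalue of the integral operator `T_p` (`heckeT_gamma1_isIntegral_of_two_le`,
`isIntegral_eigenvalue`).  Deligne–Serre 1974, (2.7.3), integrality half, in weights `≥ 2`. [cite: DeligneSerreASENS1974, Prop. 2.7 (2.7.3)] -/
theorem isIntegral_of_heckeT_gamma1_apply_eq_smul_of_two_le (hk : 2 ≤ k) {p : ℕ} [NeZero p]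
    (hp : p.Prime) {f : CuspForm (Gamma1 N) k} (hf : f ≠ 0) {a : ℂ}
    (h : heckeT (Gamma1 N) k p f = a • f) : IsIntegral ℤ a :=
  isIntegral_eigenvalue (heckeT_gamma1_isIntegral_of_two_le hk p hp) hf h

/-- **All Hecke and diamond eigenvalues of a non-zero `f ∈ S_k(Γ₁(N))`, `k ≥ 2`, lie in one subring
of `ℂ` finitely generated as a `ℤ`-module**, unconditionally: the stabiliser of the group of
periods `{φ(f) : φ ∈ periodLatticeK1 n}` (`SeparatingDualLattice.exists_fg_subalgebra_ev` with
`periodLatticeK1_fg_stable_separating`).  Deligne–Serre 1974, (2.7.3) and its proof, in weights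
`≥ 2`; Diamond–Shurman (6.12). [cite: DeligneSerreASENS1974, Prop. 2.7 (2.7.3)] -/
theorem exists_fg_subalgebra_heckeEigenvalues_of_two_le (hk : 2 ≤ k) {f : CuspForm (Gamma1 N) k}
    (hf : f ≠ 0) :
    ∃ K : Subalgebra ℤ ℂ, (Subalgebra.toSubmodule K).FG ∧
      (∀ (p : ℕ) (hp : p.Prime) (c : ℂ),
        (haveI : NeZero p := ⟨hp.ne_zero⟩; heckeT (Gamma1 N) k p) f = c • f → c ∈ K) ∧
      (∀ (d : ZMod N) (c : ℂ), diamondOp N k d f = c • f → c ∈ K) := by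
  obtain ⟨n, rfl⟩ : ∃ n : ℕ, k = (n : ℤ) + 2 := ⟨(k - 2).toNat, by omega⟩
  obtain ⟨hfg, hT, hd, hsep⟩ := periodLatticeK1_fg_stable_separating N n
  obtain ⟨K, hK, hK'⟩ := SeparatingDualLattice.exists_fg_subalgebra_ev hfg hsep hf
  refine ⟨K, hK, fun p hp c h ↦ ?_, fun d c h ↦ ?_⟩
  · haveI : NeZero p := ⟨hp.ne_zero⟩
    exact hK' _ c (fun φ hφ ↦ hT p hp φ hφ) h
  · exact hK' _ c (fun φ hφ ↦ hd d φ hφ) h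

/-- **`T_p` is integral over `ℤ` on `S_k(Γ₀(N))`, every weight `k`, unconditionally** (every
prime `p`): by the tree's dual-lattice fact in all weights `gamma0_exists_heckeStableDualLattice_holds`
(`NewformsCoeffFieldHolds`: vacuous for `k < 2`, the period lattice `periodLatticeK` for `k ≥ 2`) and
`SeparatingDualLattice.isIntegral_of_dualMap_mem`.  This is Shimura 1971, Thm. 3.48 (3) for
`Γ' = Γ₀(N)`; the tree's `heckeT_isIntegral` (`HeckeIntegrality`) assumes the maximal-rank lattice
(3.5.20) (`Shimura1971_heckeStableLattice`), which is not needed for integrality. [cite: Shimura1971, Thm. 3.48 (3)] -/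
theorem heckeT_gamma0_isIntegral (N : ℕ) [NeZero N] (k : ℤ) (p : ℕ) [NeZero p] (hp : p.Prime) :
    IsIntegral ℤ (heckeT (Gamma0 N) k p) := by
  obtain ⟨H, hfg, hT, hsep⟩ := gamma0_exists_heckeStableDualLattice_holds N k
  exact SeparatingDualLattice.isIntegral_of_dualMap_mem hfg hsep fun φ hφ ↦ hT p hp φ hφ

/-- **Hecke eigenvalues on `S_k(Γ₀(N))` are algebraic integers**, every weight and every prime,
unconditionally (`heckeT_gamma0_isIntegral`, `isIntegral_eigenvalue`); the unconditional form of
`isIntegral_of_heckeT_apply_eq_smul` of `HeckeIntegrality` (Shimura 1971, Thm. 3.48 (3)). [cite: Shimura1971, Thm. 3.48 (3)] -/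
theorem isIntegral_of_heckeT_gamma0_apply_eq_smul {p : ℕ} [NeZero p] (hp : p.Prime)
    {f : CuspForm (Gamma0 N) k} (hf : f ≠ 0) {a : ℂ} (h : heckeT (Gamma0 N) k p f = a • f) :
    IsIntegral ℤ a :=
  isIntegral_eigenvalue (heckeT_gamma0_isIntegral N k p hp) hf h

end ModularForms

/-! ## 3. Deligne–Serre 1974, (2.7.3): weights `≥ 2` unconditionally; reduction to weight one -/

namespace DeligneSerre1974

open scoped MatrixGroups
open CongruenceSubgroup

/-- **Deligne–Serre 1974, Prop. 2.7 (2.7.3) in weights `k ≥ 2`, unconditionally**: for a non-zero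
cusp form `f` of type `(k, ε)` on `Γ₀(N)`, `k ≥ 2`, which is an eigenfunction of the `T_p`, `p ∤ N`,
the eigenvalues `a_p` are algebraic integers lying in the number field `ℚ(a_p : p ∤ N)` — finite
over `ℚ` because all `a_p` lie in one subring of `ℂ` finitely generated over `ℤ`
(`exists_fg_subalgebra_heckeEigenvalues_of_two_le`, the Eichler–Shimura period lattice;
`finiteDimensional_of_le_adjoin_of_subset_fg_subalgebra`).  The statement is that of the named fact
`prop27_eigenvalues` with the extra hypothesis `2 ≤ k`; the type `(k, ε)` is not used. [cite: DeligneSerreASENS1974, Prop. 2.7 (2.7.3)] -/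
theorem prop27_eigenvalues_of_two_le ⦃N : ℕ⦄ [NeZero N] ⦃k : ℤ⦄ (hk : 2 ≤ k)
    (ε : DirichletCharacter ℂ N) (f : CuspForm (Gamma1 N) k)
    (_hfε : f ∈ nebentypusSubspace N k ε) (hf0 : f ≠ 0)
    (heig : ∀ p : ℕ, (hp : p.Prime) → ¬ p ∣ N →
      ∃ a : ℂ, (haveI : NeZero p := ⟨hp.ne_zero⟩; heckeT (Gamma1 N) k p f) = a • f) :
    ∃ K : IntermediateField ℚ ℂ, FiniteDimensional ℚ K ∧
      ∀ p : ℕ, p.Prime → ¬ p ∣ N →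
        heckeEigenvalue f p ∈ K ∧ IsIntegral ℤ (heckeEigenvalue f p) := by
  obtain ⟨K', hK'fg, hK'T, -⟩ := exists_fg_subalgebra_heckeEigenvalues_of_two_le hk hf0
  set S : Set ℂ := {a | ∃ p : ℕ, p.Prime ∧ ¬ p ∣ N ∧ a = heckeEigenvalue f p} with hS
  have hSK' : S ⊆ K' := by
    rintro _ ⟨p, hp, hpN, rfl⟩
    haveI : NeZero p := ⟨hp.ne_zero⟩
    exact hK'T p hp _ (heckeT_eq_heckeEigenvalue_smul f p (heig p hp hpN))
  refine ⟨IntermediateField.adjoin ℚ S,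
    finiteDimensional_of_le_adjoin_of_subset_fg_subalgebra K' hK'fg hSK' _ le_rfl,
    fun p hp hpN ↦ ⟨IntermediateField.subset_adjoin ℚ S ⟨p, hp, hpN, rfl⟩, ?_⟩⟩
  exact IsIntegral.of_mem_of_fg K' hK'fg _ (hSK' ⟨p, hp, hpN, rfl⟩)

/-- **The named fact `prop27_eigenvalues` is equivalent to its weight-one case**: weights `k ≤ 0`
carry no non-zero cusp forms (`cuspForm_eq_zero_of_weight_nonpos`) and weights `k ≥ 2` are settled
by `prop27_eigenvalues_of_two_le`.  Weight one is the case Deligne–Serre need (proof of Prop. 5.5,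
§8.2), and the one in which no Hecke-stable integral structure short of (2.7.2) is available. [cite: DeligneSerreASENS1974, Prop. 2.7 (2.7.3)] -/
theorem prop27_eigenvalues_iff_weight_one :
    prop27_eigenvalues ↔
      ∀ ⦃N : ℕ⦄ [NeZero N] (ε : DirichletCharacter ℂ N) (f : CuspForm (Gamma1 N) 1),
        f ∈ nebentypusSubspace N 1 ε → f ≠ 0 →
        (∀ p : ℕ, (hp : p.Prime) → ¬ p ∣ N →
          ∃ a : ℂ, (haveI : NeZero p := ⟨hp.ne_zero⟩; heckeT (Gamma1 N) 1 p f) = a • f) →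
        ∃ K : IntermediateField ℚ ℂ, FiniteDimensional ℚ K ∧
          ∀ p : ℕ, p.Prime → ¬ p ∣ N →
            heckeEigenvalue f p ∈ K ∧ IsIntegral ℤ (heckeEigenvalue f p) := by
  constructor
  · intro h N _ ε f hfε hf0 heig
    exact h ε f hfε hf0 heig
  · intro h1 N _ k ε f hfε hf0 heig
    rcases le_or_gt k 0 with hk | hk
    · exact absurd (cuspForm_eq_zero_of_weight_nonpos hk f) hf0
    rcases eq_or_lt_of_le (show (1 : ℤ) ≤ k from hk) with hk1 | hk2
    · subst hk1
      exact h1 ε f hfε hf0 heig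
    · exact prop27_eigenvalues_of_two_le (show (2 : ℤ) ≤ k by omega) ε f hfε hf0 heig

/-- **`prop27_eigenvalues` from (2.7.2) in weights `5` and `7` alone.**  Deligne–Serre's spanning
statement (2.7.2) (`DeligneSerre1974_span_integralLattice1`) in weights `5` and `7` gives it in
weight `1` (`DeligneSerre1974_span_integralLattice1.weight_one_of_five_seven`: division by `E₄` and
`E₆`, a form of Deligne–Serre's Rem. 2.8), whence the weight-one case by the lattice argument on
`integralLattice1 N 1` (`exists_fg_subalgebra_of_span_integralLattice1`, `heckeT_mem_integralLattice1`);
the other weights need nothing (`prop27_eigenvalues_iff_weight_one`).  This sharpens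
`prop27_eigenvalues_of_span_integralLattice1`, which assumes (2.7.2) in every weight. [cite: DeligneSerreASENS1974, Prop. 2.7 (2.7.2)–(2.7.3) and Rem. 2.8] -/
theorem prop27_eigenvalues_of_span_integralLattice1_five_seven
    (hL : ∀ (N : ℕ) [NeZero N],
      DeligneSerre1974_span_integralLattice1 N 5 ∧ DeligneSerre1974_span_integralLattice1 N 7) :
    prop27_eigenvalues := by
  refine prop27_eigenvalues_iff_weight_one.mpr fun N _ ε f _hfε hf0 heig ↦ ?_
  have hL1 : DeligneSerre1974_span_integralLattice1 N 1 :=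
    DeligneSerre1974_span_integralLattice1.weight_one_of_five_seven (hL N).1 (hL N).2
  obtain ⟨K', hK'fg, hK'⟩ := exists_fg_subalgebra_of_span_integralLattice1 hL1 le_rfl hf0
  set S : Set ℂ := {a | ∃ p : ℕ, p.Prime ∧ ¬ p ∣ N ∧ a = heckeEigenvalue f p} with hS
  have hSK' : S ⊆ K' := by
    rintro _ ⟨p, hp, hpN, rfl⟩
    haveI : NeZero p := ⟨hp.ne_zero⟩
    exact hK' _ _ (fun x hx ↦ heckeT_mem_integralLattice1 le_rfl hx p hp)
      (heckeT_eq_heckeEigenvalue_smul f p (heig p hp hpN))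
  refine ⟨IntermediateField.adjoin ℚ S,
    finiteDimensional_of_le_adjoin_of_subset_fg_subalgebra K' hK'fg hSK' _ le_rfl,
    fun p hp hpN ↦ ⟨IntermediateField.subset_adjoin ℚ S ⟨p, hp, hpN, rfl⟩, ?_⟩⟩
  exact IsIntegral.of_mem_of_fg K' hK'fg _ (hSK' ⟨p, hp, hpN, rfl⟩)

end DeligneSerre1974

end Literature.NumberTheory.EllipticCurves.ModularForms
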